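import Summits.ResolutionOfSingularities.ResolutionOfSingularities.Theorems.HilbertSamuelEliminationCampaignW42ToricMarkedPhase
import Summits.ResolutionOfSingularities.ResolutionOfSingularities.Theorems.HilbertSamuelEliminationCampaignW42ToricMarkedWon

/-!
# [OURS · L1 W4.2] Toric marked monomial objects in dimension 3 — brick 7F: ACTIVE PLAYS (bridge B1 in the id-model)

[OURS · L1 W4.2 · seat res-L1-s42-pv-2 gen 5] Memo `L/res-L1-s42-pv-2/CALIBRATION-W42-O2-v4.md` §4/§7 (B1).  `cornerPuzzle`'s legality asks the
blown-up face to lie in a corner that is NOT YET WON and its `done` is «every corner won» (`≤`).  By PRUNING won corners (they stay won under legal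
blow-ups, brick 7B, and never matter again) the main theorem is re-threaded: `prune` commutes with blow-ups up to pruning (`mem_prune_move_iff`), the
monomial-case potential and the phase measure of the pruned state drive the same induction as bricks 2/6C but every chosen face now lies in an ACTIVE
corner, giving **`playA_won : ∀ s, WF → Nonneg → ∃ t, PlayA m s t ∧ ∀ C ∈ t.cones, Won m t C`** (active-legal plays reach all-won states).  With
bricks 7A–7E this leaves only the dictionary with `IdeasL1Idea2R8.HStage` (list representation) for the row `InitialCornerSolvable`.  NOT a
statement of the manuscript under review.  AI work, weaker than expert review.  No `sorry`, no new axiom.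
-/

set_option linter.dupNamespace false -- mandated namespace of this single-conjunct summit

namespace Summit.ResolutionOfSingularities.ResolutionOfSingularities.Theorems.CampaignW42.Toric

namespace TState

open Finset

variable {ι : Type}

/-! ### Active corners, pruning, active plays -/

/-- **[OURS · L1 W4.2]** ACTIVE corner: not won (every generator has order `> m`; `cornerPuzzle`'s activity clause). -/
def Active (m : ℕ) (s : TState ι) (C : Finset ℕ) : Prop := ¬ s.Won m C

open Classical in
/-- **[OURS · L1 W4.2]** PRUNING: forget the won corners (they never matter again: won corners stay won). -/
noncomputable def prune (m : ℕ) (s : TState ι) : TState ι :=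
  { s with cones := s.cones.filter (fun C => s.Active m C) }

/-- **[OURS · L1 W4.2]** ACTIVE-LEGAL move: a legal face contained in some ACTIVE corner (exactly `cornerPuzzle.legal` up to the dictionary). -/
def LegalA (m : ℕ) (s : TState ι) (R : Finset ℕ) : Prop := s.Legal m R ∧ ∃ C ∈ s.cones, R ⊆ C ∧ s.Active m C

/-- **[OURS · L1 W4.2]** Plays by active-legal moves. -/
inductive PlayA (m : ℕ) : TState ι → TState ι → Prop
  | refl (s : TState ι) : PlayA m s s
  | step {s t : TState ι} (R : Finset ℕ) : s.LegalA m R → PlayA m (s.move m R) t → PlayA m s t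

/-- `PlayA` is transitive. -/
theorem PlayA.trans {m : ℕ} {s t u : TState ι} (h₁ : s.PlayA m t) (h₂ : t.PlayA m u) : s.PlayA m u := by
  induction h₁ with
  | refl s => exact h₂
  | step R hR _ ih => exact PlayA.step R hR (ih h₂)

open Classical in
/-- Membership in the pruned cone set. -/
theorem mem_prune_cones {m : ℕ} {s : TState ι} {C : Finset ℕ} : C ∈ (s.prune m).cones ↔ C ∈ s.cones ∧ s.Active m C := by
  unfold prune; rw [Finset.mem_filter]

/-- Pruning keeps the exponent table. -/
theorem prune_expo (m : ℕ) (s : TState ι) : (s.prune m).expo = s.expo := rfl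
/-- Pruning keeps the fresh-id bound. -/
theorem prune_next (m : ℕ) (s : TState ι) : (s.prune m).next = s.next := rfl
/-- Pruning keeps face sums. -/
theorem prune_faceSum (m : ℕ) (s : TState ι) (R : Finset ℕ) (v : ι) : (s.prune m).faceSum R v = s.faceSum R v := rfl

/-- Active corners are unresolved. -/
theorem Active.not_resolved {m : ℕ} {s : TState ι} {C : Finset ℕ} (h : s.Active m C) : ¬ s.Resolved m C :=
  fun hr => h (Won.of_resolved hr)

/-- Pruning keeps well-formedness. -/
theorem prune_WF {m : ℕ} {s : TState ι} (h : s.WF) : (s.prune m).WF :=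
  fun C hC => h C (mem_prune_cones.mp hC).1

/-- Pruning keeps non-negativity. -/
theorem prune_nonneg {m : ℕ} {s : TState ι} (h : s.Nonneg) : (s.prune m).Nonneg := h

/-- A legal move of the pruned state is an active-legal move of the state. -/
theorem legalA_of_legal_prune {m : ℕ} {s : TState ι} {R : Finset ℕ} (h : (s.prune m).Legal m R) : s.LegalA m R := by
  obtain ⟨⟨hne, C, hC, hRC⟩, hineq⟩ := h
  obtain ⟨hCs, hCa⟩ := mem_prune_cones.mp hC
  exact ⟨⟨⟨hne, C, hCs, hRC⟩, hineq⟩, C, hCs, hRC, hCa⟩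

/-- **Pruning commutes with blow-ups** (children of won corners are won, untouched corners keep their status): the active corners after
blowing up the state are exactly the active corners after blowing up the pruned state. -/
theorem mem_prune_move_iff {m : ℕ} {s : TState ι} (hs : s.Nonneg) (hwf : s.WF) {R : Finset ℕ} (hR : s.Legal m R) (D : Finset ℕ) :
    D ∈ ((s.move m R).prune m).cones ↔ D ∈ (((s.prune m).move m R).prune m).cones := by
  classical
  rw [mem_prune_cones, mem_prune_cones, mem_move_cones, mem_move_cones]
  have hact : ((s.prune m).move m R).Active m D ↔ (s.move m R).Active m D := Iff.rfl
  rw [hact]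
  constructor
  · rintro ⟨⟨C, hC, hDC⟩, hDa⟩
    refine ⟨⟨C, mem_prune_cones.mpr ⟨hC, fun hw => hDa ?_⟩, hDC⟩, hDa⟩
    have hnC := hwf.next_notMem hC
    by_cases hRC : R ⊆ C
    · rw [children_of_subset hRC, Finset.mem_image] at hDC
      obtain ⟨x, hx, rfl⟩ := hDC
      exact hw.child hs hR hRC hx hnC
    · rw [children_of_not_subset hRC, Finset.mem_singleton] at hDC
      subst hDC; exact hw.move_of_not_mem hnC
  · rintro ⟨⟨C, hC, hDC⟩, hDa⟩
    exact ⟨⟨C, (mem_prune_cones.mp hC).1, hDC⟩, hDa⟩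

/-- The active corners of the blown-up state are corners of the blow-up of the pruned state. -/
theorem prune_move_subset {m : ℕ} {s : TState ι} (hs : s.Nonneg) (hwf : s.WF) {R : Finset ℕ} (hR : s.Legal m R) :
    ((s.move m R).prune m).cones ⊆ ((s.prune m).move m R).cones :=
  fun D hD => (mem_prune_cones.mp ((mem_prune_move_iff hs hwf hR D).mp hD)).1

/-! ### The active monomial case -/

section ActiveMono

variable [Fintype ι] [Nonempty ι]

/-- The potential does not increase under pruning (weights are non-negative, fewer corners). -/
theorem pot_prune_le {m : ℕ} (s t : TState ι) (hexp : t.expo = s.expo) (hsub : t.cones ⊆ s.cones) : t.pot m ≤ s.pot m := by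
  unfold pot
  have hw : ∀ C, t.weight m C = s.weight m C := by
    intro C
    have hr : t.Resolved m C ↔ s.Resolved m C := by unfold Resolved faceSum; rw [hexp]
    have hb : t.betaSum C = s.betaSum C := by unfold betaSum beta; rw [hexp]
    by_cases h : s.Resolved m C
    · rw [weight_of_resolved h, weight_of_resolved (hr.mpr h)]
    · rw [weight_of_not_resolved h, weight_of_not_resolved (fun h' => h (hr.mp h')), hb]
  simp_rw [hw]
  exact Finset.sum_le_sum_of_subset_of_nonneg hsub (fun _ _ _ => Nat.zero_le _)

/-- **[OURS · L1 W4.2] THE ACTIVE MONOMIAL CASE.**  If every ACTIVE corner is principal, active-legal blow-ups lead to a state all of whose corners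
are WON. -/
theorem playA_won_of_principal {m : ℕ} (hm : 0 < m) (s : TState ι) (hwf : s.WF) (hnn : s.Nonneg)
    (hpr : ∀ C ∈ s.cones, s.Active m C → s.Principal C) : ∃ t, s.PlayA m t ∧ ∀ C ∈ t.cones, t.Won m C := by
  classical
  suffices H : ∀ n (s : TState ι), (s.prune m).pot m = n → s.WF → s.Nonneg →
      (∀ C ∈ s.cones, s.Active m C → s.Principal C) → ∃ t, s.PlayA m t ∧ ∀ C ∈ t.cones, t.Won m C from H _ s rfl hwf hnn hpr
  intro n
  induction n using Nat.strong_induction_on with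
  | _ n ih =>
    intro s hsn hwf hnn hpr
    by_cases hall : ∀ C ∈ s.cones, s.Won m C
    · exact ⟨s, PlayA.refl s, hall⟩
    · obtain ⟨C₀, hC₀'⟩ := not_forall.mp hall
      obtain ⟨hC₀, hact⟩ := Classical.not_imp.mp hC₀'
      obtain ⟨v₀, hp⟩ := hpr C₀ hC₀ hact
      have hnr : ¬ s.Resolved m C₀ := Active.not_resolved hact
      obtain ⟨R, hRC₀, hRne, hRm, hmin⟩ := exists_minimal_face hm hp hnr
      -- the move is legal in the pruned state
      have hC₀p : C₀ ∈ (s.prune m).cones := mem_prune_cones.mpr ⟨hC₀, hact⟩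
      have hlegalp : (s.prune m).Legal m R := legal_of_betaSum hC₀p hRC₀ hRne hRm
      have hlegalA : s.LegalA m R := legalA_of_legal_prune hlegalp
      -- hypotheses of `pot_move_lt` for the pruned state
      have hprp : ∀ C ∈ (s.prune m).cones, ¬ (s.prune m).Resolved m C → (s.prune m).Principal C :=
        fun C hC _ => hpr C (mem_prune_cones.mp hC).1 (mem_prune_cones.mp hC).2
      have hlt1 : ((s.prune m).move m R).pot m < (s.prune m).pot m :=
        pot_move_lt (prune_WF hwf) (prune_nonneg hnn) hprp hC₀p hnr hRC₀ hRne hRm hmin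
      have hle2 : ((s.move m R).prune m).pot m ≤ ((s.prune m).move m R).pot m :=
        pot_prune_le _ _ rfl (prune_move_subset hnn hwf hlegalA.1)
      have hlt : ((s.move m R).prune m).pot m < n := by rw [← hsn]; exact lt_of_le_of_lt hle2 hlt1
      -- principality of active corners after the move
      have hpr' : ∀ D ∈ (s.move m R).cones, (s.move m R).Active m D → (s.move m R).Principal D := by
        intro D hD hDa
        have hDp : D ∈ ((s.move m R).prune m).cones := mem_prune_cones.mpr ⟨hD, hDa⟩
        obtain ⟨hD', hDa'⟩ := mem_prune_cones.mp ((mem_prune_move_iff hnn hwf hlegalA.1 D).mp hDp)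
        exact principal_move (prune_WF hwf) (prune_nonneg hnn) hprp hlegalp D hD' (Active.not_resolved hDa')
      obtain ⟨t, hplay, hwon⟩ := ih _ hlt (s.move m R) rfl (hwf.move R) (hnn.move hlegalA.1) hpr'
      exact ⟨t, PlayA.step R hlegalA hplay, hwon⟩

end ActiveMono

/-! ### The active phase and the active main theorem -/

section ActivePhase

variable [Fintype ι] [Nonempty ι] [DecidableEq ι]

omit [DecidableEq ι] in
/-- The phase invariant passes to the pruned state. -/
theorem phaseInv_prune_of {m : ℕ} {θs : ℤ} {s t : TState ι} (hexp : t.expo = s.expo) (hnext : t.next = s.next)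
    (hsub : t.cones ⊆ s.cones) (h : s.PhaseInv m θs) : t.PhaseInv m θs := by
  obtain ⟨hwf, hnn, hθ⟩ := h
  refine ⟨fun C hC => ?_, fun r v => ?_, fun C hC hnr => ?_⟩
  · have := hwf C (hsub hC); rw [hnext]; exact this
  · rw [hexp]; exact hnn r v
  · have hr : t.Resolved m C ↔ s.Resolved m C := by unfold Resolved faceSum; rw [hexp]
    have hth : t.thetaR C = s.thetaR C := by
      unfold thetaR alphaSum alpha beta; rw [hexp]
    rw [hth]; exact hθ C (hsub hC) (fun h' => hnr (hr.mpr h'))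

/-- The phase measure does not increase under pruning. -/
theorem mu_prune_le {m : ℕ} {θs L : ℤ} (s t : TState ι) (hexp : t.expo = s.expo) (hsub : t.cones ⊆ s.cones) :
    t.mu m θs L ≤ s.mu m θs L := by
  classical
  unfold mu
  have hLam : t.Lam m θs L = s.Lam m θs L := by
    funext C
    unfold Lam kmin Kset linkT psum2 bmin2 G2 E2 IsMinimizer thetaR alphaSum alpha beta
    rw [hexp]
  rw [hLam]
  apply Multiset.map_le_map
  rw [Finset.val_le_iff]
  intro C hC
  rw [mem_thCones] at hC ⊢
  have hr : t.Resolved m C ↔ s.Resolved m C := by unfold Resolved faceSum; rw [hexp]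
  have hth : t.thetaR C = s.thetaR C := by unfold thetaR alphaSum alpha beta; rw [hexp]
  exact ⟨hsub hC.1, fun h => hC.2.1 (hr.mpr h), hth ▸ hC.2.2⟩

/-- **[OURS · L1 W4.2] THE ACTIVE PHASE LEMMA.**  From a state whose pruned state satisfies the phase invariant at `θs > 0`, active-legal
blow-ups reach a state whose pruned state still satisfies it and has all unresolved (= active) corners of residual order `< θs`. -/
theorem active_phase {m : ℕ} {θs : ℤ} (hθ : 0 < θs) :
    ∀ (s : TState ι), s.WF → s.Nonneg → (s.prune m).PhaseInv m θs →
      ∃ t, s.PlayA m t ∧ t.WF ∧ t.Nonneg ∧ (t.prune m).PhaseInv m θs ∧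
        ∀ C ∈ (t.prune m).cones, ¬ (t.prune m).Resolved m C → (t.prune m).thetaR C < θs := by
  classical
  obtain ⟨L, hL⟩ := exists_commonMult m θs
  have wf := (Descent.wellFounded_dm (r := fun a b : ℕ ×ₗ (ℕ ×ₗ ℕ) => a < b) wellFounded_lt)
  suffices H : ∀ (M : Multiset (ℕ ×ₗ (ℕ ×ₗ ℕ))) (s : TState ι), (s.prune m).mu m θs L = M → s.WF → s.Nonneg →
      (s.prune m).PhaseInv m θs → ∃ t, s.PlayA m t ∧ t.WF ∧ t.Nonneg ∧ (t.prune m).PhaseInv m θs ∧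
        ∀ C ∈ (t.prune m).cones, ¬ (t.prune m).Resolved m C → (t.prune m).thetaR C < θs from
    fun s hwf hnn h => H _ s rfl hwf hnn h
  intro M
  induction M using wf.induction with
  | _ M ih =>
    intro s hsM hwf hnn hs
    by_cases hex : ((s.prune m).thCones m θs).Nonempty
    · obtain ⟨R, hlegal, hR, hdm⟩ := exists_Q_step hθ hL hs hex
      have hlegalA : s.LegalA m R := legalA_of_legal_prune hlegal
      have hsub := prune_move_subset hnn hwf hlegalA.1
      -- measure: prune of the new state is DM-below
      have hle : ((s.move m R).prune m).mu m θs L ≤ ((s.prune m).move m R).mu m θs L :=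
        mu_prune_le _ _ rfl hsub
      have hdm' : Descent.DM (· < ·) (((s.move m R).prune m).mu m θs L) M := by
        rw [← hsM]
        rcases Descent.dm_of_le (r := fun a b : ℕ ×ₗ (ℕ ×ₗ ℕ) => a < b) hle with heq | hlt
        · rw [heq]; exact hdm
        · exact hlt.trans hdm
      have hinv' : ((s.move m R).prune m).PhaseInv m θs :=
        phaseInv_prune_of (s := (s.prune m).move m R) (t := (s.move m R).prune m) rfl rfl hsub (hs.move hR hlegal)
      obtain ⟨t, hplay, ht⟩ := ih _ hdm' (s.move m R) rfl (hwf.move R) (hnn.move hlegalA.1) hinv'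
      exact ⟨t, PlayA.step R hlegalA hplay, ht⟩
    · refine ⟨s, PlayA.refl s, hwf, hnn, hs, fun C hC hnr => ?_⟩
      have hle := hs.2.2 C hC hnr
      rcases lt_or_eq_of_le hle with hlt | heq
      · exact hlt
      · exact absurd ⟨C, mem_thCones.mpr ⟨hC, hnr, heq⟩⟩ hex

/-- **[OURS · L1 W4.2] THE ACTIVE MAIN THEOREM.**  Every well-formed state with non-negative exponents can be carried by ACTIVE-LEGAL blow-ups
(legal faces inside a corner that is not yet won — `cornerPuzzle`'s legality) to a state ALL OF WHOSE CORNERS ARE WON (`cornerPuzzle`'s `done`). -/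
theorem playA_won {m : ℕ} (hm : 0 < m) (s : TState ι) (hwf : s.WF) (hnn : s.Nonneg) :
    ∃ t, s.PlayA m t ∧ ∀ C ∈ t.cones, t.Won m C := by
  classical
  -- induction on the residual level of the pruned state
  suffices H : ∀ (n : ℕ) (s : TState ι), s.WF → s.Nonneg → (s.prune m).PhaseInv m n →
      ∃ t, s.PlayA m t ∧ ∀ C ∈ t.cones, t.Won m C from
    H _ s hwf hnn (phaseInv_sup (prune_WF hwf) (prune_nonneg hnn))
  intro n
  induction n with
  | zero =>
    intro s hwf hnn h
    apply playA_won_of_principal hm s hwf hnn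
    intro C hC hact
    have := principal_of_phaseInv_zero (by simpa using h) C (mem_prune_cones.mpr ⟨hC, hact⟩) (Active.not_resolved hact)
    exact this
  | succ n ih =>
    intro s hwf hnn h
    have hpos : (0 : ℤ) < (n + 1 : ℕ) := by exact_mod_cast Nat.succ_pos n
    obtain ⟨t, hplay, htwf, htnn, ht, hlt⟩ := active_phase hpos s hwf hnn h
    obtain ⟨u, hplay', hwon⟩ := ih t htwf htnn ⟨ht.1, ht.2.1, fun C hC hnr => by
      have := hlt C hC hnr; push_cast at this ⊢; omega⟩
    exact ⟨u, hplay.trans hplay', hwon⟩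

end ActivePhase

end TState

end Summit.ResolutionOfSingularities.ResolutionOfSingularities.Theorems.CampaignW42.Toric
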